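import Mathlib
import Literature.NumberTheory.LFunctions.Zhang2022.SkeletonPartOne
import Literature.NumberTheory.LFunctions.Zhang2022.SkeletonAssembly
import HarnessLib

/-!
# Zhang (2022), §4 p. 21, display (4.10) from Lemmas 4.1, 4.2 and 4.4 — the edge
# `Eq410 ⇐ Lemma41 ∧ Lemma42 ∧ Lemma44`, kernel-checked

Topic `Literature/NumberTheory/LFunctions/Zhang2022` (Landau–Siegel audit tree; verdict-neutral).
Y. Zhang, *Discrete mean estimates and the Landau–Siegel zero*, arXiv:2211.02515v1 (2022)
[Zhang2022LandauSiegel] — **an unrefereed manuscript under adjudication**; the nodes below are the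
skeleton's CLAIM nodes (`SkeletonPartOne`), stated not asserted. This file proves ONE EDGE between
them — DAG node `Z22:(4.10)` [Z22 p.21, (4.10), tex L1131–L1143], the manuscript's deduction

> By Lemma 4.2, `𝒜(s,ψ)` is analytic and it has the same zeros as `L(s,ψ)L(s,ψχ)` in `Ω₁`.
> Further, for `s ∈ Ω₁`, we have `F(s,ψ)⁻¹ ≪ 𝓛⁷⁹` by Lemma 4.1 and 4.2. This together with
> Lemma 4.4 implies that `𝒜(s,ψ) = 1 + ℬ(s,ψ) + O(𝓛⁻¹⁰⁰)` (4.10) for `s ∈ Ω₃`, where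
> `ℬ(s,ψ) = Z̃(s,ψ)F(1−s,ψ̄)/F(s,ψ)`.

as the kernel theorem `eq410_of : Lemma41 → Lemma42 → Lemma44 → Eq410`, with the constant
`C₄₁₀ = 2·C₄₁⁺·C₄₄⁺` (`x⁺ = max(x,0)`). The two inputs the printed deduction leaves implicit are
made explicit and discharged here:

* **`Ω₃ ⊆ Ω₁` for large `D`** (`mem_Omega1_of_mem_Omega3`): `Ω₃ = {1/2 − α < σ < 1 + α,
  |t − 2πt₀| < 𝓛₁ + 3}` (Lemma 4.4) and `Ω₁ = {1/2 − log𝓛/(100𝓛) < σ < 1 + log𝓛/(100𝓛),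
  |t − 2πt₀| < 𝓛₁ + 5}` (Lemma 4.1); `α = π/log P = π𝓛⁻⁹ ≤ log𝓛/(100𝓛)` as soon as
  `𝓛 = log D ≥ 3` (`alpha_le_of_three_le_ell`), so Lemmas 4.1 and 4.2 apply on `Ω₃`;
* **"`F(s,ψ)⁻¹ ≪ 𝓛⁷⁹` by Lemma 4.1 and 4.2"** (`inv_norm_le_two_mul_of_norm_mul_sub_one_le`):
  once `C₄₂𝓛⁻²²⁷ ≤ 1/2`, `|FG − 1| ≤ 1/2` gives `|F|·|G| ≥ 1/2`, so `F ≠ 0` and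
  `|F|⁻¹ ≤ 2|G| ≤ 2C₄₁𝓛⁷⁹`.

Then `𝒜 − 1 − ℬ = (L(s,ψ)L(s,ψχ) − F − Z̃F(1−s,ψ̄))/F` and Lemma 4.4 give
`|𝒜 − 1 − ℬ| ≤ C₄₄𝓛⁻¹⁷⁹ · 2C₄₁𝓛⁷⁹ = C₄₁₀𝓛⁻¹⁰⁰` (exponent `100 = 179 − 79`).

What is NOT asserted: Lemmas 4.1, 4.2, 4.4 themselves (they remain CLAIM nodes), hence not (4.10)
as such. Nothing about Theorems 1–2 of the source is stated or implied; nothing here bears on the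
cell's verdict on (8.24).

## References

* Y. Zhang, arXiv:2211.02515v1 (2022), §4 p. 21, (4.10); Lemmas 4.1, 4.2 (p. 16–17), 4.4 (p. 19);
  (2.6), (2.10). [cite: Zhang2022LandauSiegel, §4 (4.10)]
-/

noncomputable section

open Complex Real

namespace Literature.NumberTheory.LFunctions.Zhang2022.Skeleton

variable {D : ℕ}

/-! ## The implicit inputs of the deduction of (4.10) -/

/-- `log D ≥ 3` once `D ≥ ⌈e³⌉`. [cite: Zhang2022LandauSiegel, §2 (2.1)] -/
theorem three_le_ell_of_le (hD : ⌈Real.exp 3⌉₊ ≤ D) : 3 ≤ ell D := by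
  have h : Real.exp 3 ≤ D := le_trans (Nat.le_ceil _) (by exact_mod_cast hD)
  exact (Real.le_log_iff_exp_le (lt_of_lt_of_le (Real.exp_pos _) h)).mpr h

/-- **`α ≤ log𝓛/(100𝓛)` once `𝓛 ≥ 3`**: `α = π/log P = π𝓛⁻⁹` ((2.6), (2.10)) and
`100π𝓛 ≤ 𝓛⁹ ≤ 𝓛⁹·log 𝓛` for `𝓛 ≥ 3` (`log 3 > 1`, `3⁸ = 6561 > 100π`). This is the inclusion of the
`σ`-range of `Ω₃` (Lemma 4.4) in that of `Ω₁` (Lemma 4.1). [cite: Zhang2022LandauSiegel, §2 (2.10)] -/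
theorem alpha_le_of_three_le_ell (hℓ : 3 ≤ ell D) :
    alpha D ≤ Real.log (ell D) / (100 * ell D) := by
  have hℓ0 : 0 < ell D := by linarith
  have hlog : 1 ≤ Real.log (ell D) := by
    have h3 : (1 : ℝ) < Real.log 3 := by
      rw [Real.lt_log_iff_exp_lt (by norm_num)]
      exact Real.exp_one_lt_d9.trans (by norm_num)
    exact le_trans h3.le (Real.log_le_log (by norm_num) hℓ)
  have hπ : π < 4 := Real.pi_lt_four
  rw [alpha, bigP, Real.log_exp, div_le_div_iff₀ (pow_pos hℓ0 9) (by positivity)]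
  -- `π · (100𝓛) ≤ log 𝓛 · 𝓛⁹`
  have h8 : (6561 : ℝ) ≤ ell D ^ 8 := by
    calc (6561 : ℝ) = 3 ^ 8 := by norm_num
      _ ≤ ell D ^ 8 := by gcongr
  calc π * (100 * ell D) ≤ 4 * (100 * ell D) := by gcongr
    _ ≤ 6561 * ell D := by linarith
    _ ≤ ell D ^ 8 * ell D := by gcongr
    _ = 1 * ell D ^ 9 := by ring
    _ ≤ Real.log (ell D) * ell D ^ 9 := by gcongr

/-- **`Ω₃ ⊆ Ω₁` for `𝓛 ≥ 3`** (the `σ`-range by `alpha_le_of_three_le_ell`, the height range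
trivially: `𝓛₁ + 3 < 𝓛₁ + 5`). [cite: Zhang2022LandauSiegel, §4 Lemma 4.1, Lemma 4.4] -/
theorem mem_Omega1_of_mem_Omega3 (hℓ : 3 ≤ ell D) {s : ℂ} (hs : s ∈ Omega3 D) :
    s ∈ Omega1 D := by
  obtain ⟨h1, h2, h3⟩ := hs
  have hα := alpha_le_of_three_le_ell hℓ
  rw [Omega1, Lemma43.mem_Omega1_iff]
  exact ⟨by linarith, by linarith, by linarith⟩

/-- **"`F(s,ψ)⁻¹ ≪ 𝓛⁷⁹` by Lemma 4.1 and 4.2"**, the elementary step: if `|FG − 1| ≤ 1/2` then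
`F ≠ 0` and `|F|⁻¹ ≤ 2|G|`. [cite: Zhang2022LandauSiegel, §4 p. 21] -/
theorem inv_norm_le_two_mul_of_norm_mul_sub_one_le {F G : ℂ} (h : ‖F * G - 1‖ ≤ 1 / 2) :
    F ≠ 0 ∧ ‖F‖⁻¹ ≤ 2 * ‖G‖ := by
  have hFG : 1 / 2 ≤ ‖F‖ * ‖G‖ := by
    have h1 : ‖(1 : ℂ)‖ - ‖F * G‖ ≤ ‖1 - F * G‖ := norm_sub_norm_le _ _
    rw [norm_one, norm_sub_rev, norm_mul] at h1
    linarith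
  have hF : 0 < ‖F‖ := by
    rcases (norm_nonneg F).lt_or_eq with hF | hF
    · exact hF
    · rw [← hF, zero_mul] at hFG; norm_num at hFG
  refine ⟨norm_pos_iff.mp hF, ?_⟩
  rw [inv_le_iff_one_le_mul₀ hF]
  linarith

/-! ## The edge -/

/-- **(4.10) from Lemmas 4.1, 4.2 and 4.4** — the manuscript's deduction (§4 p. 21), kernel-checked
as an implication between the skeleton's CLAIM nodes, with the constant `C₄₁₀ = 2C₄₁⁺C₄₄⁺`: for
`D` large (`𝓛 ≥ 3` and `C₄₂𝓛⁻²²⁷ ≤ 1/2` beyond the thresholds of the three inputs), `ψ ∈ Ψ₁` and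
`s ∈ Ω₃ ⊆ Ω₁`: `|FG − 1| ≤ 1/2` (Lemma 4.2) gives `F(s,ψ) ≠ 0`, `|F|⁻¹ ≤ 2|G| ≤ 2C₄₁𝓛⁷⁹`
(Lemma 4.1), and `𝒜 − 1 − ℬ = (L(s,ψ)L(s,ψχ) − F − Z̃F(1−s,ψ̄))/F` with Lemma 4.4 gives
`|𝒜(s,ψ) − 1 − ℬ(s,ψ)| ≤ 2C₄₁C₄₄𝓛⁷⁹⁻¹⁷⁹ = C₄₁₀𝓛⁻¹⁰⁰`. DAG node `Z22:(4.10)`.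
[cite: Zhang2022LandauSiegel, §4 (4.10)] -/
theorem eq410_of (h41 : Lemma41) (h42 : Lemma42) (h44 : Lemma44) : Eq410 := by
  obtain ⟨C₁, h41⟩ := h41
  obtain ⟨C₂, h42⟩ := h42
  obtain ⟨C₄, h44⟩ := h44
  obtain ⟨D₀, hD₀⟩ := (h41.and h42).and h44
  refine ⟨2 * max C₁ 0 * max C₄ 0, max D₀ ⌈Real.exp (max 3 (2 * C₂))⌉₊,
    fun D _ χ hD hq hp x hx s hs => ?_⟩
  obtain ⟨⟨e41, e42⟩, e44⟩ := hD₀ D χ (le_trans (le_max_left _ _) hD) hq hp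
  -- the thresholds: `𝓛 ≥ 3` and `𝓛 ≥ 2C₂`
  have hDe : Real.exp (max 3 (2 * C₂)) ≤ D :=
    le_trans (Nat.le_ceil _) (by exact_mod_cast le_trans (le_max_right _ _) hD)
  have hℓmax : max 3 (2 * C₂) ≤ ell D :=
    (Real.le_log_iff_exp_le (lt_of_lt_of_le (Real.exp_pos _) hDe)).mpr hDe
  have hℓ3 : 3 ≤ ell D := le_trans (le_max_left _ _) hℓmax
  have hℓC : 2 * C₂ ≤ ell D := le_trans (le_max_right _ _) hℓmax
  have hℓ0 : 0 < ell D := by linarith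
  have hℓ1 : 1 ≤ ell D := by linarith
  -- `s ∈ Ω₁`, so Lemmas 4.1 and 4.2 apply at `s`
  have hΩ1 : s ∈ Omega1 D := mem_Omega1_of_mem_Omega3 hℓ3 hs
  have b41 := e41 x hx s hΩ1
  have b42 := e42 x hx s hΩ1
  have b44 := e44 x hx s hs
  -- `C₂𝓛⁻²²⁷ ≤ 1/2`
  have hhalf : C₂ * (ell D ^ 227)⁻¹ ≤ 1 / 2 := by
    have h227 : ell D ≤ ell D ^ 227 := by
      calc ell D = ell D ^ 1 := (pow_one _).symm
        _ ≤ ell D ^ 227 := pow_le_pow_right₀ hℓ1 (by norm_num)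
    have hpos : 0 < ell D ^ 227 := pow_pos hℓ0 _
    rw [← div_eq_mul_inv, div_le_iff₀ hpos]
    linarith
  obtain ⟨hF0, hFinv⟩ := inv_norm_le_two_mul_of_norm_mul_sub_one_le (b42.trans hhalf)
  -- `|F|⁻¹ ≤ 2|G| ≤ 2C₄₁⁺𝓛⁷⁹`
  have hG : ‖Gpoly χ x s‖ ≤ max C₁ 0 * ell D ^ 79 :=
    calc ‖Gpoly χ x s‖ ≤ ‖Fpoly χ x s‖ + ‖Gpoly χ x s‖ := le_add_of_nonneg_left (norm_nonneg _)
      _ ≤ C₁ * ell D ^ 79 := b41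
      _ ≤ max C₁ 0 * ell D ^ 79 := by gcongr; exact le_max_left _ _
  have hFinv' : ‖Fpoly χ x s‖⁻¹ ≤ 2 * (max C₁ 0 * ell D ^ 79) := hFinv.trans (by linarith)
  -- the algebra `𝒜 − 1 − ℬ = (LL − F − Z̃F̄(1−s))/F`
  have halg : calA χ x s - 1 - calB χ x s =
      (LL χ x s - Fpoly χ x s - tildeZW χ x s * FpolyBar χ x (1 - s)) / Fpoly χ x s := by
    rw [calA, calB]
    field_simp
  have b44' : ‖LL χ x s - Fpoly χ x s - tildeZW χ x s * FpolyBar χ x (1 - s)‖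
      ≤ max C₄ 0 * (ell D ^ 179)⁻¹ :=
    b44.trans (by gcongr; exact le_max_left _ _)
  have h79 : ell D ^ 79 * (ell D ^ 179)⁻¹ = (ell D ^ 100)⁻¹ := by
    field_simp
  calc ‖calA χ x s - 1 - calB χ x s‖
      = ‖LL χ x s - Fpoly χ x s - tildeZW χ x s * FpolyBar χ x (1 - s)‖ * ‖Fpoly χ x s‖⁻¹ := by
        rw [halg, norm_div, div_eq_mul_inv]
    _ ≤ (max C₄ 0 * (ell D ^ 179)⁻¹) * (2 * (max C₁ 0 * ell D ^ 79)) :=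
        mul_le_mul b44' hFinv' (inv_nonneg.mpr (norm_nonneg _)) (by positivity)
    _ = 2 * max C₁ 0 * max C₄ 0 * (ell D ^ 79 * (ell D ^ 179)⁻¹) := by ring
    _ = 2 * max C₁ 0 * max C₄ 0 * (ell D ^ 100)⁻¹ := by rw [h79]

end Literature.NumberTheory.LFunctions.Zhang2022.Skeleton
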